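import Summits.CriticalPhenomena.CardyFormulaZ2.Theorems.GluingContraction.Negative.BirthTies
import Summits.CriticalPhenomena.CardyFormulaZ2.Theorems.CardyWhiteToColouredSimilarityUpgradeStubRectangleDualityPart1

/-!
# `stub_shadowingZ` is false (crux `GluingContraction`, line `birth` = `registered`), Part B: every read state is primal-connected

Crux `CardyGluingRDE.GluingContraction` (stmt-CriticalPhenomena-8580), line `birth` (served as
`registered`).  Part B of the refutation of its registered stub `stub_shadowingZ` (Part A:
`BirthTies`, the tie criterion; Part C: `BirthStubShadowingZFalse`, the probability estimates and
the verbatim negation `stub_shadowingZ_false`).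

Deterministic lattice geometry at the COMMENSURABLE meshes `u = 1/N`, `N = n k`, `n ≥ 2`, of the
open unit square `sq 1 = (0,1)²` read at resolution `k` (the `4k` closed boundary segments
`seg 1 k (s, t)`):

* `bottom_step`, `left_step`, `right_step`, `top_step` — consecutive segments of one side are
  `discreteCrossing`-joined for EVERY configuration: the lattice vertex one row inside the window
  under their common endpoint is a tie vertex of both discrete arcs (`tie_crossing` of Part A);
* `corner_bl`, `corner_br`, `corner_tl` — the same at three corners;
* `seg_all_related` — hence all `4k` segments are related by the equivalence closure of "joined";
* `readZ_primal_eqvGen` (headline, **T1**) — for every configuration `ω`, any two boundary segments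
  are related by the equivalence closure of the primal matrix of the read state `readZ k 1 (1/N) ω`.

So at these meshes the bond-`ℤ²` reading law is carried by primal-connected states, on which the
gluing map `Ψ_k = gluingRDE planarCoinGlue` collapses (`psiCollapse_allJoined_ge_real`, landed).
-/

namespace Summit.CriticalPhenomena.CardyFormulaZ2.Theorems

namespace StubShadowingZ

open Set Metric MeasureTheory Complex
open Literature.Probability.Percolation Literature.Probability.LatticeModels
-- `dist_mk_re` / `dist_mk_im`: distances on a horizontal / vertical line (landed helper file)
open Summit.CriticalPhenomena.CardyFormulaZ2.Cruxes.SimilarityUpgrade.Stubs.RectangleDuality (dist_mk_re dist_mk_im)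

/-- Arithmetic of the commensurable mesh `1/N`, `N = n k` (`k ≥ 1`, `n ≥ 2`). [folklore] -/
theorem mesh_facts {k n N : ℕ} (hk : 1 ≤ k) (hn : 2 ≤ n) (hN : N = n * k) :
    (0 < N ∧ (0 : ℝ) < (N : ℝ)⁻¹ ∧ (N : ℝ)⁻¹ ≤ (k : ℝ)⁻¹ ∧ (N : ℝ)⁻¹ ≤ 1 - (N : ℝ)⁻¹) ∧
    ((∀ t : ℕ, (N : ℝ)⁻¹ * (((n : ℤ) * t : ℤ) : ℝ) = (t : ℝ) / k) ∧
      (N : ℝ)⁻¹ * (((N : ℤ) - 1 : ℤ) : ℝ) = 1 - (N : ℝ)⁻¹) ∧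
    ((∀ t : ℕ, 1 ≤ t → (k : ℝ)⁻¹ ≤ (t : ℝ) / k) ∧
      (∀ t : ℕ, t + 1 ≤ k → (t : ℝ) / k ≤ 1 - (k : ℝ)⁻¹) ∧
      ((k - 1 : ℕ) : ℝ) / k = 1 - (k : ℝ)⁻¹ ∧ (((k - 1 : ℕ) : ℝ) + 1) / k = 1) := by
  have hN0 : 0 < N := by rw [hN]; exact Nat.mul_pos (by omega) hk
  have hN2 : (2 : ℝ) ≤ N := by
    have : 2 * 1 ≤ n * k := Nat.mul_le_mul hn hk
    rw [hN]; exact_mod_cast this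
  have hk0 : (0 : ℝ) < k := by exact_mod_cast hk
  have hn0 : (0 : ℝ) < n := by exact_mod_cast (show 0 < n by omega)
  have hNr : (N : ℝ) = n * k := by rw [hN]; push_cast; ring
  have hN' : (0 : ℝ) < N := by exact_mod_cast hN0
  have ht0 : (0 : ℝ) < (N : ℝ)⁻¹ := inv_pos.2 hN'
  have hk1 : ((k - 1 : ℕ) : ℝ) = k - 1 := by rw [Nat.cast_sub hk, Nat.cast_one]
  refine ⟨⟨hN0, ht0, inv_anti₀ hk0 ?_, ?_⟩, ⟨fun t => ?_, ?_⟩, fun t ht => ?_, fun t ht => ?_,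
    ?_, ?_⟩
  · rw [hNr]; exact le_mul_of_one_le_left hk0.le (by exact_mod_cast (show 1 ≤ n by omega))
  · have : (N : ℝ)⁻¹ ≤ 1 / 2 := by rw [one_div]; exact inv_anti₀ two_pos hN2
    linarith
  · rw [hNr]; push_cast; field_simp
  · push_cast; rw [mul_sub, inv_mul_cancel₀ hN'.ne', mul_one]
  · rw [div_eq_mul_inv]
    exact le_mul_of_one_le_left (inv_pos.2 hk0).le (by exact_mod_cast ht)
  · have : (t : ℝ) ≤ k - 1 := by
      have h' : ((t + 1 : ℕ) : ℝ) ≤ k := by exact_mod_cast ht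
      push_cast at h'; linarith
    rw [div_le_iff₀ hk0, sub_mul, one_mul, inv_mul_cancel₀ hk0.ne']; exact this
  · rw [hk1, sub_div, div_self hk0.ne', one_div]
  · rw [hk1, sub_add_cancel, div_self hk0.ne']

section Steps

variable {k n N : ℕ}

/-- Same-side tie, bottom: consecutive bottom segments `t`, `t' = t + 1` are joined for every `ω`
(tie vertex `(n t', 1)` under the common endpoint `(t'/k, 0)`). [folklore] -/
theorem bottom_step (hk : 1 ≤ k) (hn : 2 ≤ n) (hN : N = n * k) {t t' : Fin k}
    (ht : (t' : ℕ) = t + 1) (ω : BondConfig (Site 2)) :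
    ω ∈ discreteCrossing (Set.Ioo 0 1 ×ℂ Set.Ioo 0 1) (N : ℝ)⁻¹ (seg 1 k (0, t)) (seg 1 k (0, t')) := by
  obtain ⟨⟨hN0, F1, F2, F7⟩, ⟨F3, -⟩, F5, F6, -⟩ := mesh_facts hk hn hN
  have htR : ((t' : ℕ) : ℝ) = (t : ℕ) + 1 := by exact_mod_cast ht
  have hlo : (N : ℝ)⁻¹ ≤ ((t' : ℕ) : ℝ) / k := F2.trans (F5 t' (by omega))
  have hhi : ((t' : ℕ) : ℝ) / k ≤ 1 - (N : ℝ)⁻¹ := (F6 t' (by omega)).trans (by linarith)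
  have hmem : ∀ s : Fin k, (s : ℕ) ≤ t' → (t' : ℕ) ≤ (s : ℕ) + 1 →
      (⟨((t' : ℕ) : ℝ) / k, 0⟩ : ℂ) ∈ seg 1 k (0, s) := fun s h h' =>
    mem_seg0.2 ⟨rfl, div_le_div_of_nonneg_right (by exact_mod_cast h) (Nat.cast_nonneg k),
      div_le_div_of_nonneg_right (by exact_mod_cast h') (Nat.cast_nonneg k)⟩
  have hd : dist (⟨((t' : ℕ) : ℝ) / k, (N : ℝ)⁻¹⟩ : ℂ) ⟨((t' : ℕ) : ℝ) / k, 0⟩ ≤ (N : ℝ)⁻¹ := by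
    rw [dist_mk_im, sub_zero, abs_of_pos F1]
  have hw : (⟨1 / 2, 1⟩ : ℂ) ∈ frontier (Set.Ioo 0 1 ×ℂ Set.Ioo 0 1) := mem_frontier_unitSq (by norm_num)
  exact tie_crossing hN0 (i := n * t') (j := 1) (F3 t') (by simp) hlo hhi le_rfl F7
    (Or.inr (Or.inr (Or.inl rfl))) (hmem t (by omega) (by omega)) hd hw (by simp [mem_seg0])
    (hmem t' le_rfl (by omega)) hd hw (by simp [mem_seg0]) ω

/-- Same-side tie, left: consecutive left segments are joined for every `ω` (tie vertex
`(1, n t')` beside the common endpoint `(0, t'/k)`). [folklore] -/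
theorem left_step (hk : 1 ≤ k) (hn : 2 ≤ n) (hN : N = n * k) {t t' : Fin k}
    (ht : (t' : ℕ) = t + 1) (ω : BondConfig (Site 2)) :
    ω ∈ discreteCrossing (Set.Ioo 0 1 ×ℂ Set.Ioo 0 1) (N : ℝ)⁻¹ (seg 1 k (3, t)) (seg 1 k (3, t')) := by
  obtain ⟨⟨hN0, F1, F2, F7⟩, ⟨F3, -⟩, F5, F6, -⟩ := mesh_facts hk hn hN
  have hlo : (N : ℝ)⁻¹ ≤ ((t' : ℕ) : ℝ) / k := F2.trans (F5 t' (by omega))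
  have hhi : ((t' : ℕ) : ℝ) / k ≤ 1 - (N : ℝ)⁻¹ := (F6 t' (by omega)).trans (by linarith)
  have hmem : ∀ s : Fin k, (s : ℕ) ≤ t' → (t' : ℕ) ≤ (s : ℕ) + 1 →
      (⟨0, ((t' : ℕ) : ℝ) / k⟩ : ℂ) ∈ seg 1 k (3, s) := fun s h h' =>
    mem_seg3.2 ⟨rfl, div_le_div_of_nonneg_right (by exact_mod_cast h) (Nat.cast_nonneg k),
      div_le_div_of_nonneg_right (by exact_mod_cast h') (Nat.cast_nonneg k)⟩
  have hd : dist (⟨(N : ℝ)⁻¹, ((t' : ℕ) : ℝ) / k⟩ : ℂ) ⟨0, ((t' : ℕ) : ℝ) / k⟩ ≤ (N : ℝ)⁻¹ := by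
    rw [dist_mk_re, sub_zero, abs_of_pos F1]
  have hw : (⟨1, 1 / 2⟩ : ℂ) ∈ frontier (Set.Ioo 0 1 ×ℂ Set.Ioo 0 1) := mem_frontier_unitSq (by norm_num)
  exact tie_crossing hN0 (i := 1) (j := n * t') (by simp) (F3 t') le_rfl F7 hlo hhi
    (Or.inl rfl) (hmem t (by omega) (by omega)) hd hw (by simp [mem_seg3])
    (hmem t' le_rfl (by omega)) hd hw (by simp [mem_seg3]) ω

/-- Same-side tie, right: consecutive right segments are joined for every `ω` (tie vertex
`(N-1, n t')`). [folklore] -/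
theorem right_step (hk : 1 ≤ k) (hn : 2 ≤ n) (hN : N = n * k) {t t' : Fin k}
    (ht : (t' : ℕ) = t + 1) (ω : BondConfig (Site 2)) :
    ω ∈ discreteCrossing (Set.Ioo 0 1 ×ℂ Set.Ioo 0 1) (N : ℝ)⁻¹ (seg 1 k (1, t)) (seg 1 k (1, t')) := by
  obtain ⟨⟨hN0, F1, F2, F7⟩, ⟨F3, F4⟩, F5, F6, -⟩ := mesh_facts hk hn hN
  have hlo : (N : ℝ)⁻¹ ≤ ((t' : ℕ) : ℝ) / k := F2.trans (F5 t' (by omega))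
  have hhi : ((t' : ℕ) : ℝ) / k ≤ 1 - (N : ℝ)⁻¹ := (F6 t' (by omega)).trans (by linarith)
  have hmem : ∀ s : Fin k, (s : ℕ) ≤ t' → (t' : ℕ) ≤ (s : ℕ) + 1 →
      (⟨1, ((t' : ℕ) : ℝ) / k⟩ : ℂ) ∈ seg 1 k (1, s) := fun s h h' =>
    mem_seg1.2 ⟨rfl, div_le_div_of_nonneg_right (by exact_mod_cast h) (Nat.cast_nonneg k),
      div_le_div_of_nonneg_right (by exact_mod_cast h') (Nat.cast_nonneg k)⟩
  have hd : dist (⟨1 - (N : ℝ)⁻¹, ((t' : ℕ) : ℝ) / k⟩ : ℂ) ⟨1, ((t' : ℕ) : ℝ) / k⟩ ≤ (N : ℝ)⁻¹ := by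
    rw [dist_mk_re, sub_sub_cancel_left, abs_neg, abs_of_pos F1]
  have hw : (⟨0, 1 / 2⟩ : ℂ) ∈ frontier (Set.Ioo 0 1 ×ℂ Set.Ioo 0 1) := mem_frontier_unitSq (by norm_num)
  exact tie_crossing hN0 (i := (N : ℤ) - 1) (j := n * t') F4 (F3 t') F7 le_rfl hlo hhi
    (Or.inr (Or.inl rfl)) (hmem t (by omega) (by omega)) hd hw (by simp [mem_seg1])
    (hmem t' le_rfl (by omega)) hd hw (by simp [mem_seg1]) ω

/-- Same-side tie, top: consecutive top segments are joined for every `ω` (tie vertex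
`(n t', N-1)`). [folklore] -/
theorem top_step (hk : 1 ≤ k) (hn : 2 ≤ n) (hN : N = n * k) {t t' : Fin k}
    (ht : (t' : ℕ) = t + 1) (ω : BondConfig (Site 2)) :
    ω ∈ discreteCrossing (Set.Ioo 0 1 ×ℂ Set.Ioo 0 1) (N : ℝ)⁻¹ (seg 1 k (2, t)) (seg 1 k (2, t')) := by
  obtain ⟨⟨hN0, F1, F2, F7⟩, ⟨F3, F4⟩, F5, F6, -⟩ := mesh_facts hk hn hN
  have hlo : (N : ℝ)⁻¹ ≤ ((t' : ℕ) : ℝ) / k := F2.trans (F5 t' (by omega))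
  have hhi : ((t' : ℕ) : ℝ) / k ≤ 1 - (N : ℝ)⁻¹ := (F6 t' (by omega)).trans (by linarith)
  have hmem : ∀ s : Fin k, (s : ℕ) ≤ t' → (t' : ℕ) ≤ (s : ℕ) + 1 →
      (⟨((t' : ℕ) : ℝ) / k, 1⟩ : ℂ) ∈ seg 1 k (2, s) := fun s h h' =>
    mem_seg2.2 ⟨rfl, div_le_div_of_nonneg_right (by exact_mod_cast h) (Nat.cast_nonneg k),
      div_le_div_of_nonneg_right (by exact_mod_cast h') (Nat.cast_nonneg k)⟩
  have hd : dist (⟨((t' : ℕ) : ℝ) / k, 1 - (N : ℝ)⁻¹⟩ : ℂ) ⟨((t' : ℕ) : ℝ) / k, 1⟩ ≤ (N : ℝ)⁻¹ := by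
    rw [dist_mk_im, sub_sub_cancel_left, abs_neg, abs_of_pos F1]
  have hw : (⟨1 / 2, 0⟩ : ℂ) ∈ frontier (Set.Ioo 0 1 ×ℂ Set.Ioo 0 1) := mem_frontier_unitSq (by norm_num)
  exact tie_crossing hN0 (i := n * t') (j := (N : ℤ) - 1) (F3 t') F4 hlo hhi F7 le_rfl
    (Or.inr (Or.inr (Or.inr rfl))) (hmem t (by omega) (by omega)) hd hw (by simp [mem_seg2])
    (hmem t' le_rfl (by omega)) hd hw (by simp [mem_seg2]) ω

/-- Corner tie, bottom-left: bottom segment `0` and left segment `0` are joined for every `ω`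
(tie vertex `(1, 1)`). [folklore] -/
theorem corner_bl (hk : 1 ≤ k) (hn : 2 ≤ n) (hN : N = n * k) (ω : BondConfig (Site 2)) :
    ω ∈ discreteCrossing (Set.Ioo 0 1 ×ℂ Set.Ioo 0 1) (N : ℝ)⁻¹ (seg 1 k (0, ⟨0, hk⟩))
      (seg 1 k (3, ⟨0, hk⟩)) := by
  obtain ⟨⟨hN0, F1, F2, F7⟩, -, -⟩ := mesh_facts hk hn hN
  have hdA : dist (⟨(N : ℝ)⁻¹, (N : ℝ)⁻¹⟩ : ℂ) ⟨(N : ℝ)⁻¹, 0⟩ ≤ (N : ℝ)⁻¹ := by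
    rw [dist_mk_im, sub_zero, abs_of_pos F1]
  have hdB : dist (⟨(N : ℝ)⁻¹, (N : ℝ)⁻¹⟩ : ℂ) ⟨0, (N : ℝ)⁻¹⟩ ≤ (N : ℝ)⁻¹ := by
    rw [dist_mk_re, sub_zero, abs_of_pos F1]
  refine tie_crossing hN0 (i := 1) (j := 1) (by simp) (by simp) le_rfl F7 le_rfl F7 (Or.inl rfl)
    (mem_seg0.2 ⟨rfl, by simp [F1.le], by simpa using F2⟩) hdA
    (mem_frontier_unitSq (z := ⟨1 / 2, 1⟩) (by norm_num)) (by simp [mem_seg0])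
    (mem_seg3.2 ⟨rfl, by simp [F1.le], by simpa using F2⟩) hdB
    (mem_frontier_unitSq (z := ⟨1, 1 / 2⟩) (by norm_num)) (by simp [mem_seg3]) ω

/-- Corner tie, bottom-right: bottom segment `k-1` and right segment `0` are joined for every `ω`
(tie vertex `(N-1, 1)`). [folklore] -/
theorem corner_br (hk : 1 ≤ k) (hn : 2 ≤ n) (hN : N = n * k) (ω : BondConfig (Site 2)) :
    ω ∈ discreteCrossing (Set.Ioo 0 1 ×ℂ Set.Ioo 0 1) (N : ℝ)⁻¹ (seg 1 k (0, ⟨k - 1, by omega⟩))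
      (seg 1 k (1, ⟨0, hk⟩)) := by
  obtain ⟨⟨hN0, F1, F2, F7⟩, ⟨-, F4⟩, -, -, F8, F9⟩ := mesh_facts hk hn hN
  have hdA : dist (⟨1 - (N : ℝ)⁻¹, (N : ℝ)⁻¹⟩ : ℂ) ⟨1 - (N : ℝ)⁻¹, 0⟩ ≤ (N : ℝ)⁻¹ := by
    rw [dist_mk_im, sub_zero, abs_of_pos F1]
  have hdB : dist (⟨1 - (N : ℝ)⁻¹, (N : ℝ)⁻¹⟩ : ℂ) ⟨1, (N : ℝ)⁻¹⟩ ≤ (N : ℝ)⁻¹ := by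
    rw [dist_mk_re, sub_sub_cancel_left, abs_neg, abs_of_pos F1]
  refine tie_crossing hN0 (i := (N : ℤ) - 1) (j := 1) F4 (by simp) F7 le_rfl le_rfl F7
    (Or.inr (Or.inl rfl))
    (mem_seg0.2 ⟨rfl, by simp only [F8]; linarith, by simp only [F9]; linarith⟩) hdA
    (mem_frontier_unitSq (z := ⟨1 / 2, 1⟩) (by norm_num)) (by simp [mem_seg0])
    (mem_seg1.2 ⟨rfl, by simp [F1.le], by simpa using F2⟩) hdB
    (mem_frontier_unitSq (z := ⟨0, 1 / 2⟩) (by norm_num)) (by simp [mem_seg1]) ω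

/-- Corner tie, top-left: left segment `k-1` and top segment `0` are joined for every `ω`
(tie vertex `(1, N-1)`). [folklore] -/
theorem corner_tl (hk : 1 ≤ k) (hn : 2 ≤ n) (hN : N = n * k) (ω : BondConfig (Site 2)) :
    ω ∈ discreteCrossing (Set.Ioo 0 1 ×ℂ Set.Ioo 0 1) (N : ℝ)⁻¹ (seg 1 k (3, ⟨k - 1, by omega⟩))
      (seg 1 k (2, ⟨0, hk⟩)) := by
  obtain ⟨⟨hN0, F1, F2, F7⟩, ⟨-, F4⟩, -, -, F8, F9⟩ := mesh_facts hk hn hN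
  have hdA : dist (⟨(N : ℝ)⁻¹, 1 - (N : ℝ)⁻¹⟩ : ℂ) ⟨0, 1 - (N : ℝ)⁻¹⟩ ≤ (N : ℝ)⁻¹ := by
    rw [dist_mk_re, sub_zero, abs_of_pos F1]
  have hdB : dist (⟨(N : ℝ)⁻¹, 1 - (N : ℝ)⁻¹⟩ : ℂ) ⟨(N : ℝ)⁻¹, 1⟩ ≤ (N : ℝ)⁻¹ := by
    rw [dist_mk_im, sub_sub_cancel_left, abs_neg, abs_of_pos F1]
  refine tie_crossing hN0 (i := 1) (j := (N : ℤ) - 1) (by simp) F4 le_rfl F7 F7 le_rfl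
    (Or.inl rfl)
    (mem_seg3.2 ⟨rfl, by simp only [F8]; linarith, by simp only [F9]; linarith⟩) hdA
    (mem_frontier_unitSq (z := ⟨1, 1 / 2⟩) (by norm_num)) (by simp [mem_seg3])
    (mem_seg2.2 ⟨rfl, by simp [F1.le], by simpa using F2⟩) hdB
    (mem_frontier_unitSq (z := ⟨1 / 2, 0⟩) (by norm_num)) (by simp [mem_seg2]) ω

end Steps

/-! ### T1: every read state is primal-connected -/

/-- Chaining consecutive ties along one side. [folklore] -/
theorem chain_side {k : ℕ} {R : Fin 4 × Fin k → Fin 4 × Fin k → Prop} (s : Fin 4) (hk : 1 ≤ k)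
    (h : ∀ t t' : Fin k, (t' : ℕ) = t + 1 → R (s, t) (s, t')) :
    ∀ t : Fin k, Relation.EqvGen R (s, t) (s, ⟨0, hk⟩) := by
  rintro ⟨v, hv⟩
  induction v with
  | zero => exact Relation.EqvGen.refl _
  | succ v ih =>
    exact Relation.EqvGen.trans _ _ _
      (Relation.EqvGen.symm _ _ (Relation.EqvGen.rel _ _ (h ⟨v, by omega⟩ ⟨v + 1, hv⟩ rfl)))
      (ih (by omega))

/-- At mesh `1/(n k)`, `n ≥ 2`, every two of the `4k` boundary segments (coordinate indexing) are
related by the equivalence closure of "joined by `discreteCrossing` in the unit square", for EVERY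
configuration. [folklore] -/
theorem seg_all_related {k n N : ℕ} (hk : 1 ≤ k) (hn : 2 ≤ n) (hN : N = n * k)
    (ω : BondConfig (Site 2)) (a b : Fin 4 × Fin k) :
    Relation.EqvGen (fun x y : Fin 4 × Fin k =>
      ω ∈ discreteCrossing (Set.Ioo 0 1 ×ℂ Set.Ioo 0 1) (N : ℝ)⁻¹ (seg 1 k x) (seg 1 k y)) a b := by
  set R : Fin 4 × Fin k → Fin 4 × Fin k → Prop := fun x y =>
    ω ∈ discreteCrossing (Set.Ioo 0 1 ×ℂ Set.Ioo 0 1) (N : ℝ)⁻¹ (seg 1 k x) (seg 1 k y) with hR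
  have h0 : ∀ t : Fin k, Relation.EqvGen R (0, t) (0, ⟨0, hk⟩) :=
    chain_side 0 hk fun t t' h => bottom_step hk hn hN h ω
  have h3 : ∀ t : Fin k, Relation.EqvGen R (3, t) (0, ⟨0, hk⟩) := fun t =>
    Relation.EqvGen.trans _ _ _ (chain_side 3 hk (fun t t' h => left_step hk hn hN h ω) t)
      (Relation.EqvGen.symm _ _ (Relation.EqvGen.rel _ _ (corner_bl hk hn hN ω)))
  have h1 : ∀ t : Fin k, Relation.EqvGen R (1, t) (0, ⟨0, hk⟩) := fun t =>
    Relation.EqvGen.trans _ _ _ (chain_side 1 hk (fun t t' h => right_step hk hn hN h ω) t)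
      (Relation.EqvGen.trans _ _ _
        (Relation.EqvGen.symm _ _ (Relation.EqvGen.rel _ _ (corner_br hk hn hN ω))) (h0 _))
  have h2 : ∀ t : Fin k, Relation.EqvGen R (2, t) (0, ⟨0, hk⟩) := fun t =>
    Relation.EqvGen.trans _ _ _ (chain_side 2 hk (fun t t' h => top_step hk hn hN h ω) t)
      (Relation.EqvGen.trans _ _ _
        (Relation.EqvGen.symm _ _ (Relation.EqvGen.rel _ _ (corner_tl hk hn hN ω))) (h3 _))
  have base : ∀ c : Fin 4 × Fin k, Relation.EqvGen R c (0, ⟨0, hk⟩) := by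
    rintro ⟨s, t⟩
    fin_cases s
    · exact h0 t
    · exact h1 t
    · exact h2 t
    · exact h3 t
  exact Relation.EqvGen.trans _ _ _ (base a) (Relation.EqvGen.symm _ _ (base b))

/-- **T1 — every read state is primal-connected.** For bond percolation on `ℤ²` read in the
window `sq 1 = (0,1)²` at resolution `k ≥ 1` and the commensurable mesh `u = 1/(n k)`, `n ≥ 2`,
any two boundary segments are related by the equivalence closure of the primal matrix of
`readZ k 1 u ω`, for EVERY configuration `ω` (adjacent segments share a tie vertex). [folklore] -/
theorem readZ_primal_eqvGen : ∀ {k n N : ℕ}, 1 ≤ k → 2 ≤ n → N = n * k → ∀ (ω : BondConfig (Site 2)) (a b : Fin 4 × Fin k), Relation.EqvGen (fun x y => (readZ k 1 (N : ℝ)⁻¹ ω).primal x y = true) a b := by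
  intro k n N hk hn hN ω a b
  have hiff : ∀ x y : Fin 4 × Fin k, (readZ k 1 (N : ℝ)⁻¹ ω).primal x y = true ↔
      ω ∈ discreteCrossing (Set.Ioo 0 1 ×ℂ Set.Ioo 0 1) (N : ℝ)⁻¹ (seg 1 k (toCoord x))
        (seg 1 k (toCoord y)) := by
    intro x y
    rw [primal_readZ_eq_true_iff, ccwSeg, ccwSeg, sq_one]
  rw [eqvGen_iff_of_equiv (Equiv.ofBijective toCoord toCoord_bijective)
    (r := fun x y : Fin 4 × Fin k =>
      ω ∈ discreteCrossing (Set.Ioo 0 1 ×ℂ Set.Ioo 0 1) (N : ℝ)⁻¹ (seg 1 k x) (seg 1 k y)) hiff]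
  exact seg_all_related hk hn hN ω _ _

end StubShadowingZ

end Summit.CriticalPhenomena.CardyFormulaZ2.Theorems
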